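import Mathlib
import Literature.Probability.LatticeModels.GKSInequalities
import Literature.Probability.LatticeModels.TorusTransferSpectral
import HarnessLib

/-!
# Wheel column relation (Theorem W, stub D): trace bookkeeping around the rim at base point `0`

Line Sketch of the crux `InverseMFerromagnet`, lead c6, Theorem W (inverse-M for the Ising model on every
wheel `W_n`).  Conditioning on the hub turns the rim into a `±1` ring with position-dependent transfer
matrices `T_k(a,b) = exp(h_k a + K_k ab)` (the field of site `k` sits in `T_k`), successor `finRotate n`.
This file proves the **column relation at site `0`** (`stub_wheel_column`): with `𝒜 = T₀ ⋯ T_{n-1}`,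
`S = diag(±1)` and ANY `S₊, S₋, x₀, x₋, x_c, x₊` with `T₀ S = S₊ T₀`, `S T_{n-1} = T_{n-1} S₋`,
`(x₀ I + x₋ S₋ + x_c S + x₊ S₊) 𝒜 = I`, the ring sums `Zr, A i, B i j` satisfy the hub relation (`= 2`),
vanish on every rim row `i ≠ 0`, and take the commutator value `x₊ Tr([S,S₊]𝒜)` on row `0`.

## Proof

By the cyclic trace formula `sum_prod_cyclic_eq_trace_listProd` (Kramers–Wannier / Schultz–Mattis–Lieb)
applied to the family `diag(d_j) · T_j`, every ring sum with sign insertions is the trace of the list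
product with `S` inserted at the chosen positions (`wcol_sum_eq_trace`, `wcol_prod_one`, `wcol_prod_two`).
Writing `P_i = T₀⋯T_{i-1}`, `Q_i = T_i⋯T_{n-1}` (`List.take` / `List.drop`, `𝒜 = P_i Q_i`) and
`W_i = P_i S Q_i`, for `i ≠ 0`: `A i = Tr W_i`, `B i 0 = Tr(W_i S)`, `B i 1 = Tr(W_i S₊)`,
`B i (n-1) = Tr(W_i S₋)`, so the rim combination is `Tr(W_i Y) = Tr(S · Q_i Y P_i) = Tr S = 0` because
`Y 𝒜 = I` forces `Q_i Y P_i = I` (`mul_eq_one_comm`); the hub combination is `Tr(Y𝒜) = Tr I = 2`; and on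
row `0`, `Tr(S 𝒜 Y) = Tr S = 0` leaves exactly `x₊ Tr((S S₊ − S₊ S)𝒜)`.  No invertibility of the `T_k`
beyond `Y𝒜 = I` is used.
-/

namespace Summit.CriticalPhenomena.Ising3DConformalLimit.Cruxes.InverseMFerromagnet.PartialCovarianceLadder

open Literature.Probability.LatticeModels Finset Matrix

noncomputable section

/-! ## Cyclic sums with insertions are traces -/

/-- Cyclic sums with arbitrary diagonal insertions are traces:
`∑_x ∏_j (F_j)_{x_j x_{j+1}} ∏_j d_j(x_j) = Tr ∏_j (diag d_j · F_j)`. [folklore] -/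
theorem wcol_sum_eq_trace {ι : Type*} [Fintype ι] [DecidableEq ι] (m : ℕ)
    (F : Fin (m + 1) → Matrix ι ι ℝ) (d : Fin (m + 1) → ι → ℝ) :
    ∑ x : Fin (m + 1) → ι, (∏ j, F j (x j) (x (j + 1))) * ∏ j, d j (x j) =
      ((List.ofFn fun j => diagonal (d j) * F j).prod).trace := by
  rw [← sum_prod_cyclic_eq_trace_listProd]
  refine Finset.sum_congr rfl fun x _ => ?_
  rw [mul_comm, ← Finset.prod_mul_distrib]
  simp only [Matrix.diagonal_mul]

/-- A list product `∏_k G_k F_k` with `G_k = 1` off one position `i` and `G_i = X` splits as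
`(F_0 ⋯ F_{i-1}) · X · (F_i ⋯ F_{n-1})`. [folklore] -/
theorem wcol_prod_one {R : Type*} [Monoid R] :
    ∀ (n : ℕ) (F : Fin n → R) (X : R) (i : ℕ), i < n →
      (List.ofFn fun k : Fin n => (if (k : ℕ) = i then X else 1) * F k).prod =
        ((List.ofFn F).take i).prod * (X * ((List.ofFn F).drop i).prod)
  | 0, _, _, _, hi => absurd hi (Nat.not_lt_zero _)
  | n + 1, F, X, 0, _ => by
    simp only [List.ofFn_succ, List.prod_cons, List.take_zero, List.drop_zero, List.prod_nil, one_mul,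
      Fin.val_zero, Fin.val_succ, if_true, Nat.add_one_ne_zero, if_false]
    rw [mul_assoc]
  | n + 1, F, X, i + 1, hi => by
    have ih := wcol_prod_one n (fun k => F k.succ) X i (by omega)
    simp only [List.ofFn_succ, List.prod_cons, List.take_succ_cons, List.drop_succ_cons, Fin.val_zero,
      Fin.val_succ, (Nat.succ_ne_zero i).symm, if_false, one_mul, Nat.add_right_cancel_iff]
    rw [ih, mul_assoc]

/-- A list product `∏_k G_k F_k` with `G = X` at two positions `i < j` and `G_k = 1` elsewhere splits as
`(F_0 ⋯ F_{i-1}) · X · (F_i ⋯ F_{j-1}) · X · (F_j ⋯ F_{n-1})`. [folklore] -/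
theorem wcol_prod_two {R : Type*} [Monoid R] :
    ∀ (n : ℕ) (F : Fin n → R) (X : R) (i j : ℕ), i < j → j < n →
      (List.ofFn fun k : Fin n => (if (k : ℕ) = i then X else if (k : ℕ) = j then X else 1) * F k).prod =
        ((List.ofFn F).take i).prod *
          (X * ((((List.ofFn F).take j).drop i).prod * (X * ((List.ofFn F).drop j).prod)))
  | 0, _, _, _, _, _, hj => absurd hj (Nat.not_lt_zero _)
  | _ + 1, _, _, _, 0, hij, _ => absurd hij (Nat.not_lt_zero _)
  | n + 1, F, X, 0, j + 1, _, hj => by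
    have h1 := wcol_prod_one n (fun k => F k.succ) X j (by omega)
    simp only [List.ofFn_succ, List.prod_cons, List.take_zero, List.prod_nil, one_mul, List.drop_zero,
      List.take_succ_cons, List.drop_succ_cons, Fin.val_zero, Fin.val_succ, if_true,
      Nat.add_one_ne_zero, if_false, Nat.add_right_cancel_iff]
    rw [h1]
    simp only [mul_assoc]
  | n + 1, F, X, i + 1, j + 1, hij, hj => by
    have ih := wcol_prod_two n (fun k => F k.succ) X i j (by omega) (by omega)
    simp only [List.ofFn_succ, List.prod_cons, List.take_succ_cons, List.drop_succ_cons, Fin.val_zero,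
      Fin.val_succ, (Nat.succ_ne_zero i).symm, (Nat.succ_ne_zero j).symm, if_false, one_mul,
      Nat.add_right_cancel_iff]
    rw [ih, mul_assoc]

/-- Prefix splitting: `(F_0⋯F_{i-1})(F_i⋯F_{j-1}) = F_0⋯F_{j-1}` for `i ≤ j`. [folklore] -/
theorem wcol_take_mul_drop_take {R : Type*} [Monoid R] (L : List R) {i j : ℕ} (hij : i ≤ j) :
    (L.take i).prod * ((L.take j).drop i).prod = (L.take j).prod := by
  rw [← List.prod_take_mul_prod_drop (L.take j) i, List.take_take, Nat.min_eq_left hij]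

/-- Suffix splitting: `(F_i⋯F_{j-1})(F_j⋯) = F_i⋯` for `i ≤ j ≤ |L|`. [folklore] -/
theorem wcol_drop_take_mul_drop {R : Type*} [Monoid R] (L : List R) {i j : ℕ} (hij : i ≤ j)
    (hj : j ≤ L.length) : ((L.take j).drop i).prod * (L.drop j).prod = (L.drop i).prod := by
  rw [← List.prod_append, ← List.drop_append_of_le_length, List.take_append_drop]
  rw [List.length_take, Nat.min_eq_left hj]
  exact hij

/-- The first factor: `(L.take 1).prod = F_0`. [folklore] -/
theorem wcol_take_one {R : Type*} [Monoid R] {m : ℕ} (F : Fin (m + 1) → R) :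
    ((List.ofFn F).take 1).prod = F 0 := by
  rw [List.ofFn_succ, List.take_succ_cons, List.take_zero, List.prod_cons, List.prod_nil, mul_one]

/-- The last factor: `(L.drop m).prod = F_m`. [folklore] -/
theorem wcol_drop_last {R : Type*} [Monoid R] {m : ℕ} (F : Fin (m + 1) → R) :
    ((List.ofFn F).drop m).prod = F (Fin.last m) := by
  rw [List.ofFn_succ_last, List.drop_left' (List.length_ofFn ..), List.prod_cons, List.prod_nil, mul_one]

/-! ## Assembly: the three relations from the trace identities -/

/-- **Assembly of the column relation.**  For a ring of `m + 1 ≥ 3` transfer matrices `F_k` with cyclic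
weight `w x = ∏_k (F_k)_{x_k x_{k+1}}`, monodromy `𝒜 = F_0 ⋯ F_m`, the sign matrix `S = diag(±1)` and ANY
`S₊, S₋, x₀, x₋, x_c, x₊` with `F_0 S = S₊ F_0`, `S F_m = F_m S₋`, `(x₀ I + x₋ S₋ + x_c S + x₊ S₊) 𝒜 = I`:
the hub relation, the vanishing rim rows and the commutator value on row `0`. [folklore] -/
theorem wcol_assembly {m : ℕ} (hm : 2 ≤ m) (F : Fin (m + 1) → Matrix ℤˣ ℤˣ ℝ)
    (w : (Fin (m + 1) → ℤˣ) → ℝ) (hw : ∀ x, w x = ∏ j, F j (x j) (x (j + 1)))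
    (S Sp Sm 𝒜 : Matrix ℤˣ ℤˣ ℝ) (hS : S = diagonal fun a : ℤˣ => ((a : ℤ) : ℝ))
    (h𝒜 : 𝒜 = (List.ofFn F).prod)
    (Zr : ℝ) (hZr : Zr = ∑ x, w x) (A : Fin (m + 1) → ℝ)
    (hA : ∀ i, A i = ∑ x, w x * ((x i : ℤ) : ℝ)) (B : Fin (m + 1) → Fin (m + 1) → ℝ)
    (hB : ∀ i j, B i j = ∑ x, w x * ((x i : ℤ) : ℝ) * ((x j : ℤ) : ℝ))
    (i0 i1 il : Fin (m + 1)) (hi0 : (i0 : ℕ) = 0) (hi1 : (i1 : ℕ) = 1) (hil : (il : ℕ) = m)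
    (x0 xm xc xp : ℝ) (hSp : F i0 * S = Sp * F i0) (hSm : S * F il = F il * Sm)
    (hY : (x0 • (1 : Matrix ℤˣ ℤˣ ℝ) + xm • Sm + xc • S + xp • Sp) * 𝒜 = 1) :
    (x0 * Zr + xm * A il + xc * A i0 + xp * A i1 = 2) ∧
    (∀ i : Fin (m + 1), i ≠ i0 → x0 * A i + xm * B i il + xc * B i i0 + xp * B i i1 = 0) ∧
    (x0 * A i0 + xm * B i0 il + xc * B i0 i0 + xp * B i0 i1 =
      xp * Matrix.trace ((S * Sp - Sp * S) * 𝒜)) := by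
  -- the special sites
  have e0 : i0 = 0 := Fin.ext (by rw [hi0, Fin.val_zero])
  have el : il = Fin.last m := Fin.ext (by rw [hil, Fin.val_last])
  subst e0 el
  obtain ⟨L, hL⟩ : ∃ L, L = List.ofFn F := ⟨_, rfl⟩
  rw [← hL] at h𝒜
  have hlen : L.length = m + 1 := by rw [hL, List.length_ofFn]
  -- sign facts
  have hSS : S * S = 1 := by
    rw [hS, diagonal_mul_diagonal, ← diagonal_one]
    exact congrArg diagonal (funext fun a => by rw [← Int.cast_mul, Int.units_coe_mul_self, Int.cast_one])
  have htrS : trace S = 0 := by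
    rw [hS, trace_diagonal, show (univ : Finset ℤˣ) = {1, -1} from rfl, Finset.sum_pair (by decide)]
    simp
  have htr1 : trace (1 : Matrix ℤˣ ℤˣ ℝ) = 2 := by
    rw [trace_one, Fintype.card_units_int]; norm_num
  -- the cyclic trace formula with diagonal insertions
  have key : ∀ d : Fin (m + 1) → ℤˣ → ℝ,
      ∑ x, w x * ∏ j, d j (x j) = trace (List.ofFn fun j => diagonal (d j) * F j).prod := by
    intro d
    simp_rw [hw]
    exact wcol_sum_eq_trace m F d
  have hZ : Zr = trace 𝒜 := by
    rw [hZr, h𝒜, hL, ← sum_prod_cyclic_eq_trace_listProd]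
    exact Finset.sum_congr rfl fun x _ => hw x
  -- one insertion
  have hAi : ∀ i : Fin (m + 1), A i = trace ((L.take i).prod * (S * (L.drop i).prod)) := by
    intro i
    have h1 : ∑ x, w x * ∏ j : Fin (m + 1), (if (j : ℕ) = i then ((x j : ℤ) : ℝ) else 1) =
        trace (List.ofFn fun j : Fin (m + 1) =>
          diagonal (fun a : ℤˣ => if (j : ℕ) = i then ((a : ℤ) : ℝ) else 1) * F j).prod :=
      key fun (j : Fin (m + 1)) (a : ℤˣ) => if (j : ℕ) = i then ((a : ℤ) : ℝ) else 1
    have h2 : (fun j : Fin (m + 1) =>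
          diagonal (fun a : ℤˣ => if (j : ℕ) = i then ((a : ℤ) : ℝ) else 1) * F j) =
        fun k : Fin (m + 1) => (if (k : ℕ) = i then S else 1) * F k := by
      funext k
      split_ifs <;> simp [hS]
    rw [hA, hL, ← wcol_prod_one (m + 1) F S i i.isLt, ← h2, ← h1]
    refine Finset.sum_congr rfl fun x _ => ?_
    rw [Fintype.prod_eq_single i]
    · rw [if_pos rfl]
    · intro j hj
      exact if_neg (Fin.val_ne_of_ne hj)
  -- two insertions
  have hB2 : ∀ i j : Fin (m + 1), (i : ℕ) < j → B i j =
      trace ((L.take i).prod * (S * (((L.take j).drop i).prod * (S * (L.drop j).prod)))) := by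
    intro i j hij
    have hne : i ≠ j := fun h => absurd hij (by rw [h]; exact lt_irrefl _)
    have h1 : ∑ x, w x * ∏ k : Fin (m + 1),
          (if (k : ℕ) = i then ((x k : ℤ) : ℝ) else if (k : ℕ) = j then ((x k : ℤ) : ℝ) else 1) =
        trace (List.ofFn fun k : Fin (m + 1) => diagonal (fun a : ℤˣ =>
          if (k : ℕ) = i then ((a : ℤ) : ℝ) else if (k : ℕ) = j then ((a : ℤ) : ℝ) else 1) * F k).prod :=
      key fun (k : Fin (m + 1)) (a : ℤˣ) =>
        if (k : ℕ) = i then ((a : ℤ) : ℝ) else if (k : ℕ) = j then ((a : ℤ) : ℝ) else 1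
    have h2 : (fun k : Fin (m + 1) => diagonal (fun a : ℤˣ =>
          if (k : ℕ) = i then ((a : ℤ) : ℝ) else if (k : ℕ) = j then ((a : ℤ) : ℝ) else 1) * F k) =
        fun k : Fin (m + 1) => (if (k : ℕ) = i then S else if (k : ℕ) = j then S else 1) * F k := by
      funext k
      split_ifs <;> simp [hS]
    rw [hB, hL, ← wcol_prod_two (m + 1) F S i j hij j.isLt, ← h2, ← h1]
    refine Finset.sum_congr rfl fun x _ => ?_
    rw [Fintype.prod_eq_mul i j hne]
    · rw [if_pos rfl, if_neg (Fin.val_ne_of_ne hne.symm), if_pos rfl, mul_assoc]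
    · rintro k ⟨hki, hkj⟩
      rw [if_neg (Fin.val_ne_of_ne hki), if_neg (Fin.val_ne_of_ne hkj)]
  have hBsymm : ∀ i j, B i j = B j i := fun i j => by
    rw [hB, hB]
    exact Finset.sum_congr rfl fun x _ => by ring
  have hBii : ∀ i, B i i = Zr := fun i => by
    rw [hB, hZr]
    exact Finset.sum_congr rfl fun x _ => by
      rw [mul_assoc, ← Int.cast_mul, Int.units_coe_mul_self, Int.cast_one, mul_one]
  -- splitting the monodromy
  have hPQ : ∀ i : ℕ, 𝒜 = (L.take i).prod * (L.drop i).prod := fun i => by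
    rw [h𝒜, List.prod_take_mul_prod_drop]
  have hP0 : (L.take 0).prod = 1 := by rw [List.take_zero, List.prod_nil]
  have hR0 : ∀ j : ℕ, (L.take j).drop 0 = L.take j := fun j => List.drop_zero
  have hP1 : (L.take 1).prod = F 0 := by rw [hL]; exact wcol_take_one F
  have hQm : (L.drop m).prod = F (Fin.last m) := by rw [hL]; exact wcol_drop_last F
  have hPR : ∀ {i j : ℕ}, i ≤ j → (L.take i).prod * ((L.take j).drop i).prod = (L.take j).prod :=
    fun h => wcol_take_mul_drop_take L h
  have hRQ : ∀ {i j : ℕ}, i ≤ j → j ≤ m + 1 →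
      ((L.take j).drop i).prod * (L.drop j).prod = (L.drop i).prod :=
    fun h h' => wcol_drop_take_mul_drop L h (hlen ▸ h')
  -- the hub entries
  have hA0 : A 0 = trace (S * 𝒜) := by
    rw [hAi 0, Fin.val_zero, hP0, List.drop_zero, ← h𝒜, Matrix.one_mul]
  have hA1 : A i1 = trace (Sp * 𝒜) := by
    rw [hAi i1, hi1, hP1, ← Matrix.mul_assoc, hSp, Matrix.mul_assoc, ← hP1, ← hPQ 1]
  have hAl : A (Fin.last m) = trace (Sm * 𝒜) := by
    rw [hAi (Fin.last m), Fin.val_last, hQm, hSm, ← Matrix.mul_assoc, ← hQm, ← hPQ m, trace_mul_comm]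
  refine ⟨?_, ?_, ?_⟩
  · -- hub relation: `Tr (Y 𝒜) = Tr 1 = 2`
    have h2 : trace ((x0 • (1 : Matrix ℤˣ ℤˣ ℝ) + xm • Sm + xc • S + xp • Sp) * 𝒜) = 2 := by
      rw [hY, htr1]
    rw [hZ, hAl, hA0, hA1, ← h2]
    simp only [Matrix.add_mul, Matrix.smul_mul, Matrix.one_mul, trace_add, trace_smul, smul_eq_mul]
  · -- rim rows `i ≠ 0`: the combination is `Tr (P S Q Y) = Tr (S (Q Y P)) = Tr S = 0`
    intro i hi
    have hi' : 0 < (i : ℕ) := Nat.pos_of_ne_zero fun h => hi (Fin.ext (by rw [h, Fin.val_zero]))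
    have hBl : B i (Fin.last m) = trace ((L.take i).prod * (S * ((L.drop i).prod * Sm))) := by
      rcases Nat.lt_or_ge (i : ℕ) m with h | h
      · rw [hB2 i (Fin.last m) (by rw [Fin.val_last]; exact h), Fin.val_last, hQm, hSm,
          ← Matrix.mul_assoc ((L.take m).drop i).prod, ← hQm, hRQ h.le (Nat.le_succ m)]
      · have ei : i = Fin.last m := Fin.ext (by rw [Fin.val_last]; omega)
        rw [ei, hBii, hZ, Fin.val_last, hQm, ← hSm, ← Matrix.mul_assoc S S, hSS, Matrix.one_mul, ← hQm,
          ← hPQ m]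
    have hB0 : B i 0 = trace ((L.take i).prod * (S * ((L.drop i).prod * S))) := by
      rw [hBsymm, hB2 0 i (by rw [Fin.val_zero]; exact hi'), Fin.val_zero, hP0, Matrix.one_mul, hR0,
        trace_mul_comm, Matrix.mul_assoc, Matrix.mul_assoc]
    have hB1 : B i i1 = trace ((L.take i).prod * (S * ((L.drop i).prod * Sp))) := by
      rcases Nat.lt_or_ge 1 (i : ℕ) with h | h
      · rw [hBsymm, hB2 i1 i (by rw [hi1]; exact h), hi1, hP1, ← Matrix.mul_assoc (F 0), hSp,
          Matrix.mul_assoc Sp, ← Matrix.mul_assoc (F 0), ← hP1, hPR h.le, trace_mul_comm, Matrix.mul_assoc,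
          Matrix.mul_assoc]
      · have ei : i = i1 := Fin.ext (by omega)
        rw [ei, hBii, hZ, hi1, hP1,
          show F 0 * (S * ((L.drop 1).prod * Sp)) = (F 0 * (S * (L.drop 1).prod)) * Sp from by
            simp only [Matrix.mul_assoc],
          trace_mul_comm,
          show Sp * (F 0 * (S * (L.drop 1).prod)) = (Sp * F 0) * (S * (L.drop 1).prod) from by
            simp only [Matrix.mul_assoc],
          ← hSp,
          show F 0 * S * (S * (L.drop 1).prod) = F 0 * ((S * S) * (L.drop 1).prod) from by
            simp only [Matrix.mul_assoc],
          hSS, Matrix.one_mul, ← hP1, ← hPQ 1]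
    have hQYP : (L.drop i).prod * ((x0 • (1 : Matrix ℤˣ ℤˣ ℝ) + xm • Sm + xc • S + xp • Sp) *
        (L.take i).prod) = 1 := by
      rw [mul_eq_one_comm, Matrix.mul_assoc, ← hPQ i]
      exact hY
    have expand : x0 * trace ((L.take i).prod * (S * (L.drop i).prod)) +
        xm * trace ((L.take i).prod * (S * ((L.drop i).prod * Sm))) +
        xc * trace ((L.take i).prod * (S * ((L.drop i).prod * S))) +
        xp * trace ((L.take i).prod * (S * ((L.drop i).prod * Sp))) =
        trace ((L.take i).prod * (S * ((L.drop i).prod *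
          (x0 • (1 : Matrix ℤˣ ℤˣ ℝ) + xm • Sm + xc • S + xp • Sp)))) := by
      simp only [Matrix.mul_add, Matrix.mul_smul, Matrix.mul_one, trace_add, trace_smul, smul_eq_mul]
    rw [hAi i, hBl, hB0, hB1, expand, trace_mul_comm, Matrix.mul_assoc, Matrix.mul_assoc, hQYP,
      Matrix.mul_one, htrS]
  · -- row `0`: `Tr (S 𝒜 Y) = Tr S = 0` and the commutator
    have hB0l : B 0 (Fin.last m) = trace (S * (𝒜 * Sm)) := by
      rw [hB2 0 (Fin.last m) (by rw [Fin.val_zero, Fin.val_last]; omega), Fin.val_zero, Fin.val_last, hP0,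
        Matrix.one_mul, hR0, hQm, hSm, ← Matrix.mul_assoc (L.take m).prod, ← hQm, ← hPQ m]
    have hB01 : B 0 i1 = trace (S * (Sp * 𝒜)) := by
      rw [hB2 0 i1 (by rw [Fin.val_zero, hi1]; omega), Fin.val_zero, hi1, hP0, Matrix.one_mul, hR0, hP1,
        ← Matrix.mul_assoc (F 0), hSp, Matrix.mul_assoc, ← hP1, ← hPQ 1]
    have hB00 : B 0 0 = trace 𝒜 := by rw [hBii, hZ]
    have hAY : trace (S * (𝒜 * (x0 • (1 : Matrix ℤˣ ℤˣ ℝ) + xm • Sm + xc • S + xp • Sp))) = 0 := by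
      rw [mul_eq_one_comm.mp hY, Matrix.mul_one, htrS]
    simp only [Matrix.mul_add, Matrix.mul_smul, Matrix.mul_one, trace_add, trace_smul, smul_eq_mul] at hAY
    have h1 : trace (S * (𝒜 * S)) = trace 𝒜 := by
      rw [← Matrix.mul_assoc, trace_mul_comm, ← Matrix.mul_assoc, hSS, Matrix.one_mul]
    have h2 : trace (S * (𝒜 * Sp)) = trace (Sp * S * 𝒜) := by
      rw [← Matrix.mul_assoc, trace_mul_comm, Matrix.mul_assoc]
    rw [h1, h2] at hAY
    rw [hA0, hB0l, hB00, hB01, Matrix.sub_mul, trace_sub, Matrix.mul_assoc S Sp 𝒜]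
    linear_combination hAY

/-! ## Stub D: the column relation (trace bookkeeping around the ring, base point `k = 0`) -/

/-- **Stub D (column relation at site 0).**  Let `T_k = T(K_k,h_k)`, `𝒜 = T₀T₁⋯T_{n−1}` (ring monodromy at `0`),
`ℓ = n−1`.  For ANY matrices `S₊, S₋` with `T₀ S = S₊ T₀`, `S T_ℓ = T_ℓ S₋` and ANY reals with
`(x₀ I + x₋ S₋ + x_c S + x₊ S₊) 𝒜 = I`, the ring sums satisfy the hub relation (`= 2`), vanish on every rim row
`i ≠ 0`, and take the commutator value on row `0` (cyclic trace formula `sum_prod_cyclic_eq_trace_listProd`). [folklore] -/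
theorem stub_wheel_column :
    ∀ (n : ℕ) (hn : 3 ≤ n) (K h : Fin n → ℝ), (∀ k, 0 < K k) →
      let T : ℝ → ℝ → Matrix ℤˣ ℤˣ ℝ := fun K' h' =>
        Matrix.of fun a b : ℤˣ => Real.exp (h' * ((a : ℤ) : ℝ) + K' * (((a : ℤ) : ℝ) * ((b : ℤ) : ℝ)))
      let S : Matrix ℤˣ ℤˣ ℝ := Matrix.diagonal fun a : ℤˣ => ((a : ℤ) : ℝ)
      let 𝒜 : Matrix ℤˣ ℤˣ ℝ := (List.ofFn fun k : Fin n => T (K k) (h k)).prod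
      let w : (Fin n → ℤˣ) → ℝ := fun x =>
        Real.exp (∑ k : Fin n, (K k * (((x k : ℤ) : ℝ) * ((x (finRotate n k) : ℤ) : ℝ)) + h k * ((x k : ℤ) : ℝ)))
      let Zr : ℝ := ∑ x : Fin n → ℤˣ, w x
      let A : Fin n → ℝ := fun i => ∑ x : Fin n → ℤˣ, w x * ((x i : ℤ) : ℝ)
      let B : Fin n → Fin n → ℝ := fun i j => ∑ x : Fin n → ℤˣ, w x * ((x i : ℤ) : ℝ) * ((x j : ℤ) : ℝ)
      let i0 : Fin n := ⟨0, by omega⟩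
      let i1 : Fin n := ⟨1, by omega⟩
      let il : Fin n := ⟨n - 1, by omega⟩
      ∀ (Sp Sm : Matrix ℤˣ ℤˣ ℝ) (x0 xm xc xp : ℝ),
        T (K i0) (h i0) * S = Sp * T (K i0) (h i0) →
        S * T (K il) (h il) = T (K il) (h il) * Sm →
        (x0 • (1 : Matrix ℤˣ ℤˣ ℝ) + xm • Sm + xc • S + xp • Sp) * 𝒜 = 1 →
        (x0 * Zr + xm * A il + xc * A i0 + xp * A i1 = 2) ∧
        (∀ i : Fin n, i ≠ i0 → x0 * A i + xm * B i il + xc * B i i0 + xp * B i i1 = 0) ∧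
        (x0 * A i0 + xm * B i0 il + xc * B i0 i0 + xp * B i0 i1 = xp * Matrix.trace ((S * Sp - Sp * S) * 𝒜)) := by
  intro n hn K h _
  obtain ⟨m, rfl⟩ : ∃ m, n = m + 1 := ⟨n - 1, by omega⟩
  intro T S 𝒜 w Zr A B i0 i1 il Sp Sm x0 xm xc xp hSp hSm hY
  refine wcol_assembly (m := m) (by omega) (fun k => T (K k) (h k)) w ?_ S Sp Sm 𝒜 rfl rfl Zr rfl A
    (fun _ => rfl) B (fun _ _ => rfl) i0 i1 il rfl rfl (Nat.add_sub_cancel m 1) x0 xm xc xp hSp hSm hY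
  intro x
  simp only [w, T, Real.exp_sum, Matrix.of_apply, finRotate_apply]
  exact Finset.prod_congr rfl fun j _ => by rw [add_comm]

end

end Summit.CriticalPhenomena.Ising3DConformalLimit.Cruxes.InverseMFerromagnet.PartialCovarianceLadder
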